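import Literature.RingTheory.FormalGroups.FormalGroupHeightKernel
import HarnessLib

/-!
# `ker [ϖ^m]_F = ker Frob_{q^{hm}}`: the ideal of `[ϖ^m]_F` is `(X^{q^{hm}})` for a formal `𝒪`-module law of height `h`
# ([Harris–Taylor 2001] §II.1 p. 59; [Fröhlich 1968] I §3; P6d sub-line `F0_P6d_FormalModuleKernels`, letter (HL-B))

Topic `Literature/RingTheory/FormalGroups`; namespace `Literature.RingTheory.FormalGroups`.  THEOREMS ONLY (no definition, no named
fact, no instance, no notation, no `sorry`).  Cell `hodgecm-mathlib`, P6 «MOD programme» ROW 4B, desk F0P6d-plan (g0) sub-line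
`Cruxes/HLiu418/Lines/F0_P6d_FormalModuleKernels.lean` letter (HL-B) `KernelIdealOfHeight` (ORD `h = 1`: `ker [ϖ] = ker F_q`; SS `h = 2`:
`ker [ϖ] = ker F_{q²}`); the case `m = 1` is ★ `FormalOModuleLaw.span_act_eq_span_X_pow` (`FormalGroupHeightKernel`).

## Contents

* series algebra: `constantCoeff_subst_eq_of_constantCoeff_eq_zero` («`(w(g))(0) = w(0)` when `g(0) = 0`»), `isUnit_subst_of_isUnit`
  (substituting into a unit of `A⟦X⟧` gives a unit), `subst_X_pow_mul` (`(X^N·w)(g) = g^N · w(g)`).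
* **`FormalOModuleLaw.exists_isUnit_act_pow_eq_X_pow_mul`** — `M.IsOfHeight ϖ q h`, `0 < q` ⟹ `∀ m, ∃ w ∈ A⟦X⟧ˣ, [ϖ^m]_F = X^{q^{hm}}·w`
  (induction through ★ `act_mul`: `[ϖ^{m+1}](X) = [ϖ^m]([ϖ](X))`).
* **`FormalOModuleLaw.kernelIdealOfHeight`** = letter (HL-B) with its binders token for token:
  `∀ 𝒪 A M ϖ q h, 0 < q → M.IsOfHeight ϖ q h → ∀ m, Ideal.span {[ϖ^m]_F} = Ideal.span {X^{q^{hm}}}`.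
-/

noncomputable section

namespace Literature.RingTheory.FormalGroups

universe u v

variable {A : Type v} [CommRing A]

/-! ## §1 Series algebra -/

/-- `(w(g))(0) = w(0)` when `g(0) = 0`: write `w = w(0) + X·w′`. [cite: BourbakiAlgebraII2003, Ch. IV §4 no. 3] -/
theorem constantCoeff_subst_eq_of_constantCoeff_eq_zero {g : PowerSeries A} (hg : PowerSeries.constantCoeff g = 0) (w : PowerSeries A) :
    PowerSeries.constantCoeff (PowerSeries.subst g w) = PowerSeries.constantCoeff w := by
  have hgs : PowerSeries.HasSubst g := PowerSeries.HasSubst.of_constantCoeff_zero' hg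
  obtain ⟨w', hw'⟩ : PowerSeries.X ∣ w - PowerSeries.C (PowerSeries.constantCoeff w) :=
    PowerSeries.X_dvd_iff.mpr (by simp)
  have hw : w = PowerSeries.C (PowerSeries.constantCoeff w) + PowerSeries.X * w' := by rw [← hw']; ring
  conv_lhs => rw [hw]
  rw [PowerSeries.subst_add hgs, PowerSeries.subst_mul hgs, PowerSeries.subst_C, PowerSeries.subst_X hgs]
  change PowerSeries.constantCoeff (PowerSeries.C (PowerSeries.constantCoeff w) + g * PowerSeries.subst g w') = _
  rw [map_add, map_mul, hg, zero_mul, add_zero, PowerSeries.constantCoeff_C]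

/-- Substituting a series without constant term into a UNIT of `A⟦X⟧` gives a unit. [cite: BourbakiAlgebraII2003, Ch. IV §4 no. 4] -/
theorem isUnit_subst_of_isUnit {g : PowerSeries A} (hg : PowerSeries.constantCoeff g = 0) {w : PowerSeries A} (hw : IsUnit w) :
    IsUnit (PowerSeries.subst g w) := by
  rw [PowerSeries.isUnit_iff_constantCoeff, constantCoeff_subst_eq_of_constantCoeff_eq_zero hg]
  exact PowerSeries.isUnit_iff_constantCoeff.mp hw

/-- `(X^N · w)(g) = g^N · w(g)`. [cite: BourbakiAlgebraII2003, Ch. IV §4 no. 3] -/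
theorem subst_X_pow_mul {g : PowerSeries A} (hg : PowerSeries.constantCoeff g = 0) (N : ℕ) (w : PowerSeries A) :
    PowerSeries.subst g ((PowerSeries.X : PowerSeries A) ^ N * w) = g ^ N * PowerSeries.subst g w := by
  have hgs : PowerSeries.HasSubst g := PowerSeries.HasSubst.of_constantCoeff_zero' hg
  rw [PowerSeries.subst_mul hgs, PowerSeries.subst_pow hgs, PowerSeries.subst_X hgs]

/-! ## §2 `[ϖ^m]_F = X^{q^{hm}} · unit` -/

namespace FormalOModuleLaw

variable {𝒪 : Type u} [CommRing 𝒪] [Algebra 𝒪 A]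

/-- `[a]_F(0) = 0` as a series identity. [cite: Drinfeld1974, §1] -/
theorem constantCoeff_act (M : FormalOModuleLaw 𝒪 A) (a : 𝒪) : PowerSeries.constantCoeff (M.act a).toPowerSeries = 0 :=
  (M.act a).constantCoeff_eq_zero

/-- **`[ϖ^m]_F = X^{q^{hm}} · w_m` with `w_m` a unit of `A⟦X⟧`**, for a formal `𝒪`-module law of height `h` (`0 < q`), every `m`:
induction via `[ϖ^{m+1}](X) = [ϖ^m]([ϖ](X))` (★ `act_mul`) and `[ϖ] = X^{q^h}·v` (★ `exists_isUnit_act_eq_X_pow_mul`).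
[cite: HarrisTaylorAMS2001, §II.1 p. 59] -/
theorem exists_isUnit_act_pow_eq_X_pow_mul {M : FormalOModuleLaw 𝒪 A} {ϖ : 𝒪} {q h : ℕ} (hq : 0 < q) (hM : M.IsOfHeight ϖ q h) :
    ∀ m : ℕ, ∃ w : PowerSeries A, IsUnit w ∧ (M.act (ϖ ^ m)).toPowerSeries = (PowerSeries.X : PowerSeries A) ^ (q ^ (h * m)) * w
  | 0 => ⟨1, isUnit_one, by rw [pow_zero, M.act_one, mul_zero, pow_zero, pow_one, mul_one]⟩
  | m + 1 => by
    obtain ⟨w, hw, hm⟩ := exists_isUnit_act_pow_eq_X_pow_mul hq hM m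
    obtain ⟨v, hv, h1⟩ := exists_isUnit_act_eq_X_pow_mul hM (pow_ne_zero h hq.ne')
    have h0 : PowerSeries.constantCoeff (M.act ϖ).toPowerSeries = 0 := M.constantCoeff_act ϖ
    refine ⟨v ^ (q ^ (h * m)) * PowerSeries.subst (M.act ϖ).toPowerSeries w, (hv.pow _).mul (isUnit_subst_of_isUnit h0 hw), ?_⟩
    rw [pow_succ, M.act_mul, hm, subst_X_pow_mul h0, h1, mul_pow, ← pow_mul,
      show q ^ h * q ^ (h * m) = q ^ (h * (m + 1)) by rw [← pow_add, Nat.mul_succ, add_comm]]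
    ring

/-- **Letter (HL-B) `KernelIdealOfHeight` of the P6d sub-line `F0_P6d_FormalModuleKernels` — token for token**: for every formal
`𝒪`-module law `M` over an `𝒪`-algebra `A`, `0 < q`, `M.IsOfHeight ϖ q h` ⟹ `∀ m, Ideal.span {[ϖ^m]_F} = Ideal.span {X^{q^{hm}}}` in `A⟦X⟧`
(«`ker [ϖ^m] = ker F_{q^{hm}}`»; ORD `h = 1`, SS `h = 2`). [cite: HarrisTaylorAMS2001, §II.1 p. 59] [cite: Frohlich1968, Ch. I §3] -/
theorem kernelIdealOfHeight :
    ∀ (𝒪 : Type u) [CommRing 𝒪] (A : Type v) [CommRing A] [Algebra 𝒪 A] (M : FormalOModuleLaw 𝒪 A) (ϖ : 𝒪) (q h : ℕ),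
      0 < q → M.IsOfHeight ϖ q h →
        ∀ m : ℕ, Ideal.span {(M.act (ϖ ^ m)).toPowerSeries} = Ideal.span {(PowerSeries.X : PowerSeries A) ^ (q ^ (h * m))} := by
  intro 𝒪 _ A _ _ M ϖ q h hq hM m
  obtain ⟨w, hw, hm⟩ := exists_isUnit_act_pow_eq_X_pow_mul hq hM m
  rw [hm, Ideal.span_singleton_mul_right_unit hw]

end FormalOModuleLaw

end Literature.RingTheory.FormalGroups
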